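import Literature.NumberTheory.Sieve.BombieriFriedlanderIwaniecLemma6
import HarnessLib

/-!
# Bombieri–Friedlander–Iwaniec 1986, Theorem 1: `ℛ₁` in the range (8.5)–(8.6), from Lemma 1

Topic `Literature/NumberTheory/Sieve`.  Part of the assembly of the proof of Theorem 1 of
E. Bombieri, J. B. Friedlander, H. Iwaniec, *Primes in arithmetic progressions to large moduli*,
Acta Math. 156 (1986), 203–251.  The file `…Theorem1R1` proves (8.2),
`‖ℛ₁‖ ≤ 2(2M+Y)Q₀²/(QR)·√(T_γ²(2Q+1)T_τ‖β‖⁴)·√((T_γ/Q)²T_τ(E+E))` with `E` any bound for BFI's sum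
`𝒜(±a; 4NQ, 2N, 2N/R, H, 2Q)`, and `…Lemma6` proves Lemma 6 (8.4) for `𝒜` from Lemma 1
(`BFI.L6.dispA_le_of_lemma1`, hypothesis `BFI.Lemma1BoundFor BFI.plateau2 (5/4)`).  Here the two
are combined with the numerics of p. 227–228: under (8.5) `N²Q < x^{1−ε}` one has `HK ≪ Q` (and
`H ≪ Q`), so that Lemma 6 gives
`𝒜(4NQ,2N,K,H,2Q) ≪ x^ε{N³M⁻¹Q⁴ + N^{3/2}M⁻¹Q^{11/2}R^{1/2} + N²M⁻¹Q⁵R^{1/2}}`, hence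
`ℛ₁ ≪ ‖β‖²R⁻¹x^{1/2+ε}{NQ^{1/2} + N^{1/4}Q^{5/4}R^{1/4} + N^{1/2}QR^{1/4}} ≪ ‖β‖²R⁻¹x^{1−ε}` under (8.6)
`NQ⁵R < x^{2−ε}`, `N²Q⁴R < x^{2−ε}`.

* `BFI.lemma6_rhs_le_of_range` — the numerics: with `H ≤ 16x^{ε/8}Q²R/M`, `x^{2ε}N²Q ≤ x`,
  `x^εNQ⁵R ≤ x²`, `x^εN²Q⁴R ≤ x²`, `x^εR ≤ N` and `x^{ε/8} ≥ 2²⁴`, the right-hand side of (8.4) at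
  `(4NQ, 2N, 2N/R, H, 2Q)` with `η = ε/160` is `≤ 3N²Q³x^{−3ε/16}`.
* **`BFI.norm_calR1_le_of_lemma1`** — `‖ℛ₁‖ ≤ 5√(24C₆) Q₀²T_γ²T_τ x^{1−3ε/32}‖β‖²/R` in that range,
  for BFI's weight `f = bump M (M/2)`, from `BFI.Lemma1BoundFor BFI.plateau2 (5/4)`.

Everything here is PROVED; no named facts are introduced (Lemma 1 = Deshouillers–Iwaniec enters as
the hypothesis `hLB`, exactly as in `…Lemma6`).

## References

* E. Bombieri, J. B. Friedlander, H. Iwaniec, Acta Math. 156 (1986), 203–251, §8 (8.2)–(8.6),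
  Lemma 6, Theorem 1, pp. 226–228. [BombieriFriedlanderIwaniecActa1986]
-/

noncomputable section

open Finset Real
open scoped ArithmeticFunction.sigma

namespace Literature.NumberTheory.Sieve

namespace BFI

/-! ### Absorbing constants: `c x^a ≤ x^b` once `x^{ε/8} ≥ 2²⁴ ≥ c` and `a + ε/8 ≤ b` -/

/-- If `x ≥ 1`, `2²⁴ ≤ x^{ε/8}`, `c ≤ 2²⁴` and `a + ε/8 ≤ b` then `c x^a ≤ x^b`. [folklore] -/
theorem const_mul_rpow_le_rpow {x ε c a b : ℝ} (hx : 1 ≤ x) (hxε : (2 : ℝ) ^ 24 ≤ x ^ (ε / 8))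
    (hc : c ≤ (2 : ℝ) ^ 24) (hab : a + ε / 8 ≤ b) : c * x ^ a ≤ x ^ b := by
  have hx0 : 0 < x := by linarith
  calc c * x ^ a ≤ x ^ (ε / 8) * x ^ a :=
        mul_le_mul_of_nonneg_right (hc.trans hxε) (Real.rpow_nonneg hx0.le _)
    _ = x ^ (a + ε / 8) := by rw [← Real.rpow_add hx0]; ring_nf
    _ ≤ x ^ b := Real.rpow_le_rpow_of_exponent_le hx hab

/-- `x ≥ 2²⁴` once `x ≥ 1`, `ε ≤ 8` and `x^{ε/8} ≥ 2²⁴`. [folklore] -/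
theorem two_pow_le_of_rpow {x ε : ℝ} (hx : 1 ≤ x) (hε : ε ≤ 8)
    (hxε : (2 : ℝ) ^ 24 ≤ x ^ (ε / 8)) : (2 : ℝ) ^ 24 ≤ x := by
  calc (2 : ℝ) ^ 24 ≤ x ^ (ε / 8) := hxε
    _ ≤ x ^ (1 : ℝ) := Real.rpow_le_rpow_of_exponent_le hx (by linarith)
    _ = x := Real.rpow_one x

/-! ### The numerics of BFI p. 227–228 -/

/-- **Lemma 6 in the range of Theorem 1** (BFI p. 227–228: "Assume that `N²Q < x^{1−ε}` (8.5). Then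
`HK ≪ Q`, so Lemma 6 yields `𝒜(4NQ,2N,K,H,2Q) ≪ x^ε{N³M⁻¹Q⁴ + N^{3/2}M⁻¹Q^{11/2}R^{1/2} + N²M⁻¹Q⁵R^{1/2}}`
… This bound satisfies (7.6) provided (8.5) and `NQ⁵R < x^{2−ε}`, `N²Q⁴R < x^{2−ε}` (8.6)").  In
explicit form: for `x ≥ 1` with `x^{ε/8} ≥ 2²⁴`, `0 < ε ≤ 1`, `MN = x`, `M, N ≥ 1`, `Q, R ≥ 1/2`,
`x^εR ≤ N`, `x^{2ε}N²Q ≤ x`, `x^εNQ⁵R ≤ x²`, `x^εN²Q⁴R ≤ x²` and `0 ≤ H ≤ 16x^{ε/8}Q²R/M`, the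
right-hand side of (8.4) at `(C,D,K,H,Q) = (4NQ,2N,2N/R,H,2Q)`, `η = ε/160`, is at most
`3N²Q³x^{−3ε/16}`. [cite: BombieriFriedlanderIwaniecActa1986, §8 pp. 227–228] -/
theorem lemma6_rhs_le_of_range {x ε M N Q R H : ℝ} (hx : 1 ≤ x)
    (hxε : (2 : ℝ) ^ 24 ≤ x ^ (ε / 8)) (hε : 0 < ε) (hε1 : ε ≤ 1) (hMN : M * N = x)
    (hM : 1 ≤ M) (hN : 1 ≤ N) (hQ : 1 / 2 ≤ Q) (hR : 1 / 2 ≤ R) (hRN : x ^ ε * R ≤ N)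
    (h85 : x ^ (2 * ε) * (N ^ 2 * Q) ≤ x) (h86a : x ^ ε * (N * Q ^ 5 * R) ≤ x ^ 2)
    (h86b : x ^ ε * (N ^ 2 * Q ^ 4 * R) ≤ x ^ 2) (hH0 : 0 ≤ H)
    (hH : H ≤ 16 * x ^ (ε / 8) * Q ^ 2 * R / M) :
    (4 * N * Q * (2 * N) * H * (2 * N / R) * (2 * Q)) ^ (ε / 160) *
        (4 * N * Q * (2 * N) * H * (2 * N / R) * (2 * Q) +
          H * ((2 * N / R) * (2 * Q)) ^ (1 / 2 : ℝ) * (H + 2 * Q) ^ (1 / 2 : ℝ) *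
            (4 * N * Q * ((2 * Q) ^ 2 + H * (2 * N / R) * (2 * Q)) * (4 * N * Q + 2 * N * (2 * Q) ^ 2) +
              (4 * N * Q) ^ 2 * (2 * N) * (2 * Q) *
                ((2 * Q) ^ 2 + H * (2 * N / R) * (2 * Q)) ^ (1 / 2 : ℝ) +
              (2 * N) ^ 2 * H * (2 * N / R) * (2 * Q) ^ 3) ^ (1 / 2 : ℝ)) ≤
      3 * N ^ 2 * Q ^ 3 * x ^ (-(3 * ε / 16)) := by
  have hx0 : 0 < x := by linarith
  have hN0 : 0 < N := by linarith
  have hM0 : 0 < M := by linarith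
  have hQ0 : 0 < Q := by linarith
  have hR0 : 0 < R := by linarith
  have hrp : ∀ t : ℝ, 0 < x ^ t := fun t => Real.rpow_pos_of_pos hx0 t
  have hx24 : (2 : ℝ) ^ 24 ≤ x := two_pow_le_of_rpow hx (by linarith) hxε
  -- `H x ≤ 16 x^{ε/8} Q² R N`
  have hHx : H * x ≤ 16 * x ^ (ε / 8) * Q ^ 2 * R * N := by
    have h1 : H * M ≤ 16 * x ^ (ε / 8) * Q ^ 2 * R := (le_div_iff₀ hM0).1 hH
    calc H * x = H * M * N := by rw [← hMN]; ring
      _ ≤ 16 * x ^ (ε / 8) * Q ^ 2 * R * N := mul_le_mul_of_nonneg_right h1 hN0.le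
  -- (a) `HK ≤ Q`
  have hHK : H * (2 * N / R) ≤ Q := by
    refine le_of_mul_le_mul_right ?_ hx0
    have h2 : 32 * x ^ (ε / 8) ≤ x ^ (2 * ε) :=
      const_mul_rpow_le_rpow hx hxε (by norm_num) (by linarith)
    calc H * (2 * N / R) * x = 2 * N / R * (H * x) := by ring
      _ ≤ 2 * N / R * (16 * x ^ (ε / 8) * Q ^ 2 * R * N) :=
          mul_le_mul_of_nonneg_left hHx (by positivity)
      _ = (32 * x ^ (ε / 8)) * (N ^ 2 * Q) * Q := by field_simp; ring
      _ ≤ x ^ (2 * ε) * (N ^ 2 * Q) * Q := by gcongr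
      _ ≤ x * Q := mul_le_mul_of_nonneg_right h85 hQ0.le
      _ = Q * x := by ring
  -- (b) `H ≤ 2Q`
  have hH2Q : H ≤ 2 * Q := by
    have hQRN : x ^ (3 * ε) * (Q * R * N) ≤ x := by
      calc x ^ (3 * ε) * (Q * R * N) = x ^ (2 * ε) * (N * Q) * (x ^ ε * R) := by
            rw [show (3 : ℝ) * ε = 2 * ε + ε by ring, Real.rpow_add hx0]; ring
        _ ≤ x ^ (2 * ε) * (N * Q) * N := by gcongr
        _ = x ^ (2 * ε) * (N ^ 2 * Q) := by ring
        _ ≤ x := h85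
    refine le_of_mul_le_mul_right ?_ hx0
    have h2 : 8 * x ^ (ε / 8) ≤ x ^ (3 * ε) :=
      const_mul_rpow_le_rpow hx hxε (by norm_num) (by linarith)
    calc H * x ≤ 16 * x ^ (ε / 8) * Q ^ 2 * R * N := hHx
      _ = 2 * Q * ((8 * x ^ (ε / 8)) * (Q * R * N)) := by ring
      _ ≤ 2 * Q * (x ^ (3 * ε) * (Q * R * N)) := by gcongr
      _ ≤ 2 * Q * x := by gcongr
  have hH4Q : H + 2 * Q ≤ 4 * Q := by linarith
  -- (c) the bracket of (8.4)
  have hin : (2 * Q) ^ 2 + H * (2 * N / R) * (2 * Q) ≤ 6 * Q ^ 2 := by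
    have := mul_le_mul_of_nonneg_right hHK (by positivity : (0 : ℝ) ≤ 2 * Q)
    nlinarith only [this]
  have hsq : ((2 * Q) ^ 2 + H * (2 * N / R) * (2 * Q)) ^ (1 / 2 : ℝ) ≤ 5 * Q / 2 := by
    have h1 : (2 * Q) ^ 2 + H * (2 * N / R) * (2 * Q) ≤ (5 * Q / 2) ^ 2 := by
      nlinarith only [hin, sq_nonneg Q]
    calc ((2 * Q) ^ 2 + H * (2 * N / R) * (2 * Q)) ^ (1 / 2 : ℝ)
        ≤ ((5 * Q / 2) ^ 2) ^ (1 / 2 : ℝ) := Real.rpow_le_rpow (by positivity) h1 (by norm_num)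
      _ = 5 * Q / 2 := by
          rw [← Real.sqrt_eq_rpow, Real.sqrt_sq (by positivity)]
  have hB0 : 0 ≤ 4 * N * Q * ((2 * Q) ^ 2 + H * (2 * N / R) * (2 * Q)) * (4 * N * Q + 2 * N * (2 * Q) ^ 2) +
      (4 * N * Q) ^ 2 * (2 * N) * (2 * Q) * ((2 * Q) ^ 2 + H * (2 * N / R) * (2 * Q)) ^ (1 / 2 : ℝ) +
      (2 * N) ^ 2 * H * (2 * N / R) * (2 * Q) ^ 3 := by positivity
  have hQ4 : N ^ 2 * Q ^ 4 ≤ 2 * (N ^ 2 * Q ^ 5) := by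
    have : Q ^ 4 ≤ 2 * Q ^ 5 := by nlinarith only [pow_pos hQ0 4, hQ]
    nlinarith only [this, pow_pos hN0 2]
  have hN2Q : N ^ 2 * Q ≤ x := by
    calc N ^ 2 * Q = 1 * (N ^ 2 * Q) := by ring
      _ ≤ x ^ (2 * ε) * (N ^ 2 * Q) :=
          mul_le_mul_of_nonneg_right (Real.one_le_rpow hx (by linarith)) (by positivity)
      _ ≤ x := h85
  have hNx : N ≤ x := by
    by_cases hN2 : N ≤ 2
    · linarith only [hN2, hx24]
    · have hN2' : 2 < N := lt_of_not_ge hN2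
      nlinarith only [hN2Q, hN2', hQ, hN0]
  have hQx : Q ≤ 2 * x := by
    have h1 : (1 : ℝ) ≤ N ^ 2 := one_le_pow₀ hN
    have h2 : Q ≤ N ^ 2 * Q := le_mul_of_one_le_left hQ0.le h1
    linarith only [h2, hN2Q, hx0]
  have hT0 : 0 ≤ 4 * N * Q * (2 * N) * H * (2 * N / R) * (2 * Q) +
      H * ((2 * N / R) * (2 * Q)) ^ (1 / 2 : ℝ) * (H + 2 * Q) ^ (1 / 2 : ℝ) *
        (4 * N * Q * ((2 * Q) ^ 2 + H * (2 * N / R) * (2 * Q)) * (4 * N * Q + 2 * N * (2 * Q) ^ 2) +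
          (4 * N * Q) ^ 2 * (2 * N) * (2 * Q) *
            ((2 * Q) ^ 2 + H * (2 * N / R) * (2 * Q)) ^ (1 / 2 : ℝ) +
          (2 * N) ^ 2 * H * (2 * N / R) * (2 * Q) ^ 3) ^ (1 / 2 : ℝ) := by positivity
  set B : ℝ := 4 * N * Q * ((2 * Q) ^ 2 + H * (2 * N / R) * (2 * Q)) * (4 * N * Q + 2 * N * (2 * Q) ^ 2) +
      (4 * N * Q) ^ 2 * (2 * N) * (2 * Q) * ((2 * Q) ^ 2 + H * (2 * N / R) * (2 * Q)) ^ (1 / 2 : ℝ) +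
      (2 * N) ^ 2 * H * (2 * N / R) * (2 * Q) ^ 3 with hBdef
  have hBle : B ≤ 16 * N ^ 2 * Q ^ 4 * (28 * Q + 10 * N) := by
    have h1 : 4 * N * Q * ((2 * Q) ^ 2 + H * (2 * N / R) * (2 * Q)) * (4 * N * Q + 2 * N * (2 * Q) ^ 2)
        ≤ 4 * N * Q * (6 * Q ^ 2) * (4 * N * Q + 2 * N * (2 * Q) ^ 2) := by gcongr
    have h2 : (4 * N * Q) ^ 2 * (2 * N) * (2 * Q) *
        ((2 * Q) ^ 2 + H * (2 * N / R) * (2 * Q)) ^ (1 / 2 : ℝ) ≤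
        (4 * N * Q) ^ 2 * (2 * N) * (2 * Q) * (5 * Q / 2) :=
      mul_le_mul_of_nonneg_left hsq (by positivity)
    have h3 : (2 * N) ^ 2 * H * (2 * N / R) * (2 * Q) ^ 3 ≤ (2 * N) ^ 2 * Q * (2 * Q) ^ 3 := by
      have e : (2 * N) ^ 2 * H * (2 * N / R) * (2 * Q) ^ 3 =
          (2 * N) ^ 2 * (H * (2 * N / R)) * (2 * Q) ^ 3 := by ring
      rw [e]; gcongr
    have hsum := add_le_add (add_le_add h1 h2) h3
    rw [hBdef]
    refine hsum.trans ?_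
    have e : 4 * N * Q * (6 * Q ^ 2) * (4 * N * Q + 2 * N * (2 * Q) ^ 2) +
        (4 * N * Q) ^ 2 * (2 * N) * (2 * Q) * (5 * Q / 2) + (2 * N) ^ 2 * Q * (2 * Q) ^ 3 =
        128 * (N ^ 2 * Q ^ 4) + 192 * (N ^ 2 * Q ^ 5) + 160 * (N ^ 3 * Q ^ 4) := by ring
    rw [e, show 16 * N ^ 2 * Q ^ 4 * (28 * Q + 10 * N) = 448 * (N ^ 2 * Q ^ 5) + 160 * (N ^ 3 * Q ^ 4)
      by ring]
    linarith only [hQ4, hN0, hQ0, mul_nonneg (pow_nonneg hN0.le 3) (pow_nonneg hQ0.le 4)]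
  -- (d) the core inequality from (8.6): `16384 x^{3ε/4} N Q⁴ R (28Q+10N) ≤ x²`
  have hcore : 16384 * x ^ (3 * ε / 4) * (N * Q ^ 4 * R * (28 * Q + 10 * N)) ≤ x ^ 2 := by
    have h86 : x ^ ε * (N * Q ^ 4 * R * (28 * Q + 10 * N)) ≤ 38 * x ^ 2 := by
      have e : x ^ ε * (N * Q ^ 4 * R * (28 * Q + 10 * N)) =
          28 * (x ^ ε * (N * Q ^ 5 * R)) + 10 * (x ^ ε * (N ^ 2 * Q ^ 4 * R)) := by ring
      rw [e]; linarith only [h86a, h86b]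
    have hc : (16384 * 38) * x ^ (3 * ε / 4) ≤ x ^ ε :=
      const_mul_rpow_le_rpow hx hxε (by norm_num) (by linarith)
    have h0 : 0 ≤ N * Q ^ 4 * R * (28 * Q + 10 * N) := by positivity
    calc 16384 * x ^ (3 * ε / 4) * (N * Q ^ 4 * R * (28 * Q + 10 * N))
        = ((16384 * 38) * x ^ (3 * ε / 4)) * (N * Q ^ 4 * R * (28 * Q + 10 * N)) / 38 := by ring
      _ ≤ x ^ ε * (N * Q ^ 4 * R * (28 * Q + 10 * N)) / 38 := by gcongr
      _ ≤ 38 * x ^ 2 / 38 := by gcongr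
      _ = x ^ 2 := by ring
  -- (e) the front factor `H (KQ')^{1/2} (H+Q')^{1/2} B^{1/2} ≤ 2N²Q³x^{-ε/4}` (compare squares)
  have hF : H * ((2 * N / R) * (2 * Q)) ^ (1 / 2 : ℝ) * (H + 2 * Q) ^ (1 / 2 : ℝ) * B ^ (1 / 2 : ℝ) ≤
      2 * N ^ 2 * Q ^ 3 * x ^ (-(ε / 4)) := by
    simp only [← Real.sqrt_eq_rpow]
    have hK0 : 0 ≤ 2 * N / R * (2 * Q) := by positivity
    have hKH0 : 0 ≤ 2 * N / R * (2 * Q) * (H + 2 * Q) := by positivity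
    have hrhs0 : 0 ≤ 2 * N ^ 2 * Q ^ 3 * x ^ (-(ε / 4)) := by positivity
    have e1 : Real.sqrt (2 * N / R * (2 * Q)) * Real.sqrt (H + 2 * Q) * Real.sqrt B =
        Real.sqrt (2 * N / R * (2 * Q) * (H + 2 * Q) * B) := by
      rw [Real.sqrt_mul hKH0 B, Real.sqrt_mul hK0 (H + 2 * Q)]
    -- the key comparison of squares
    have key : H ^ 2 * (2 * N / R * (2 * Q) * (H + 2 * Q) * B) ≤
        (2 * N ^ 2 * Q ^ 3 * x ^ (-(ε / 4))) ^ 2 := by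
      have hH2x : H ^ 2 * x ^ 2 ≤ 256 * x ^ (ε / 4) * Q ^ 4 * R ^ 2 * N ^ 2 := by
        have h1 : (H * x) ^ 2 ≤ (16 * x ^ (ε / 8) * Q ^ 2 * R * N) ^ 2 :=
          pow_le_pow_left₀ (by positivity) hHx 2
        have e : (x ^ (ε / 8)) ^ 2 = x ^ (ε / 4) := by
          rw [← Real.rpow_natCast, ← Real.rpow_mul hx0.le]; ring_nf
        calc H ^ 2 * x ^ 2 = (H * x) ^ 2 := by ring
          _ ≤ (16 * x ^ (ε / 8) * Q ^ 2 * R * N) ^ 2 := h1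
          _ = 256 * (x ^ (ε / 8)) ^ 2 * Q ^ 4 * R ^ 2 * N ^ 2 := by ring
          _ = 256 * x ^ (ε / 4) * Q ^ 4 * R ^ 2 * N ^ 2 := by rw [e]
      have hx2 : (x ^ (-(ε / 4))) ^ 2 = x ^ (-(ε / 2)) := by
        rw [← Real.rpow_natCast, ← Real.rpow_mul hx0.le]; ring_nf
      have e_rhs : (2 * N ^ 2 * Q ^ 3 * x ^ (-(ε / 4))) ^ 2 = 4 * N ^ 4 * Q ^ 6 * x ^ (-(ε / 2)) := by
        rw [mul_pow, hx2]; ring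
      rw [e_rhs]
      -- multiply through by `x² x^{ε/2} > 0`
      have hxx : 0 < x ^ 2 * x ^ (ε / 2) := by positivity
      refine le_of_mul_le_mul_right ?_ hxx
      have e_r : 4 * N ^ 4 * Q ^ 6 * x ^ (-(ε / 2)) * (x ^ 2 * x ^ (ε / 2)) = 4 * N ^ 4 * Q ^ 6 * x ^ 2 := by
        rw [Real.rpow_neg hx0.le]; field_simp
      rw [e_r]
      have s1 : H ^ 2 * x ^ 2 * (2 * N / R * (2 * Q)) ≤
          256 * x ^ (ε / 4) * Q ^ 4 * R ^ 2 * N ^ 2 * (2 * N / R * (2 * Q)) :=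
        mul_le_mul_of_nonneg_right hH2x hK0
      have s2 : H ^ 2 * x ^ 2 * (2 * N / R * (2 * Q)) * (H + 2 * Q) ≤
          256 * x ^ (ε / 4) * Q ^ 4 * R ^ 2 * N ^ 2 * (2 * N / R * (2 * Q)) * (4 * Q) :=
        mul_le_mul s1 hH4Q (by positivity) (by positivity)
      have s3 : H ^ 2 * x ^ 2 * (2 * N / R * (2 * Q)) * (H + 2 * Q) * B ≤
          256 * x ^ (ε / 4) * Q ^ 4 * R ^ 2 * N ^ 2 * (2 * N / R * (2 * Q)) * (4 * Q) *
            (16 * N ^ 2 * Q ^ 4 * (28 * Q + 10 * N)) :=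
        mul_le_mul s2 hBle hB0 (by positivity)
      have s4 := mul_le_mul_of_nonneg_right s3 (le_of_lt (hrp (ε / 2)))
      calc H ^ 2 * (2 * N / R * (2 * Q) * (H + 2 * Q) * B) * (x ^ 2 * x ^ (ε / 2))
          = H ^ 2 * x ^ 2 * (2 * N / R * (2 * Q)) * (H + 2 * Q) * B * x ^ (ε / 2) := by ring
        _ ≤ 256 * x ^ (ε / 4) * Q ^ 4 * R ^ 2 * N ^ 2 * (2 * N / R * (2 * Q)) * (4 * Q) *
            (16 * N ^ 2 * Q ^ 4 * (28 * Q + 10 * N)) * x ^ (ε / 2) := s4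
        _ = 4 * N ^ 4 * Q ^ 6 * (16384 * (x ^ (ε / 4) * x ^ (ε / 2)) *
              (N * Q ^ 4 * R * (28 * Q + 10 * N))) := by
            field_simp
            ring
        _ = 4 * N ^ 4 * Q ^ 6 * (16384 * x ^ (3 * ε / 4) * (N * Q ^ 4 * R * (28 * Q + 10 * N))) := by
            rw [← Real.rpow_add hx0]; ring_nf
        _ ≤ 4 * N ^ 4 * Q ^ 6 * x ^ 2 := mul_le_mul_of_nonneg_left hcore (by positivity)
    calc H * Real.sqrt (2 * N / R * (2 * Q)) * Real.sqrt (H + 2 * Q) * Real.sqrt B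
        = H * (Real.sqrt (2 * N / R * (2 * Q)) * Real.sqrt (H + 2 * Q) * Real.sqrt B) := by ring
      _ = Real.sqrt (H ^ 2 * (2 * N / R * (2 * Q) * (H + 2 * Q) * B)) := by
          rw [e1, Real.sqrt_mul (sq_nonneg H), Real.sqrt_sq hH0]
      _ ≤ Real.sqrt ((2 * N ^ 2 * Q ^ 3 * x ^ (-(ε / 4))) ^ 2) := Real.sqrt_le_sqrt key
      _ = 2 * N ^ 2 * Q ^ 3 * x ^ (-(ε / 4)) := Real.sqrt_sq hrhs0
  -- (f) the product term `P = CDHKQ'`: `P x ≤ 512 x^{ε/8} N⁴ Q⁴`, `P ≤ N²Q³x^{-ε/4}`, `P ≤ x^{10}`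
  have hPx : 4 * N * Q * (2 * N) * H * (2 * N / R) * (2 * Q) * x ≤ 512 * x ^ (ε / 8) * N ^ 4 * Q ^ 4 := by
    calc 4 * N * Q * (2 * N) * H * (2 * N / R) * (2 * Q) * x
        = 32 * N ^ 3 * Q ^ 2 / R * (H * x) := by field_simp; ring
      _ ≤ 32 * N ^ 3 * Q ^ 2 / R * (16 * x ^ (ε / 8) * Q ^ 2 * R * N) :=
          mul_le_mul_of_nonneg_left hHx (by positivity)
      _ = 512 * x ^ (ε / 8) * N ^ 4 * Q ^ 4 := by field_simp; ring
  have hP0 : 0 ≤ 4 * N * Q * (2 * N) * H * (2 * N / R) * (2 * Q) := by positivity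
  have hP1 : 4 * N * Q * (2 * N) * H * (2 * N / R) * (2 * Q) ≤ N ^ 2 * Q ^ 3 * x ^ (-(ε / 4)) := by
    have hxx : 0 < x * x ^ (ε / 4) := by positivity
    refine le_of_mul_le_mul_right ?_ hxx
    have e_r : N ^ 2 * Q ^ 3 * x ^ (-(ε / 4)) * (x * x ^ (ε / 4)) = N ^ 2 * Q ^ 3 * x := by
      rw [Real.rpow_neg hx0.le]; field_simp
    rw [e_r]
    have hc : 512 * x ^ (3 * ε / 8) ≤ x ^ (2 * ε) :=
      const_mul_rpow_le_rpow hx hxε (by norm_num) (by linarith)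
    calc 4 * N * Q * (2 * N) * H * (2 * N / R) * (2 * Q) * (x * x ^ (ε / 4))
        = (4 * N * Q * (2 * N) * H * (2 * N / R) * (2 * Q) * x) * x ^ (ε / 4) := by ring
      _ ≤ 512 * x ^ (ε / 8) * N ^ 4 * Q ^ 4 * x ^ (ε / 4) :=
          mul_le_mul_of_nonneg_right hPx (by positivity)
      _ = N ^ 2 * Q ^ 3 * ((512 * (x ^ (ε / 8) * x ^ (ε / 4))) * (N ^ 2 * Q)) := by ring
      _ = N ^ 2 * Q ^ 3 * ((512 * x ^ (3 * ε / 8)) * (N ^ 2 * Q)) := by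
          rw [← Real.rpow_add hx0]; ring_nf
      _ ≤ N ^ 2 * Q ^ 3 * (x ^ (2 * ε) * (N ^ 2 * Q)) := by gcongr
      _ ≤ N ^ 2 * Q ^ 3 * x := by gcongr
  have hP10 : 4 * N * Q * (2 * N) * H * (2 * N / R) * (2 * Q) ≤ x ^ (10 : ℝ) := by
    have hxe : x ^ (ε / 8) ≤ x := by
      calc x ^ (ε / 8) ≤ x ^ (1 : ℝ) := Real.rpow_le_rpow_of_exponent_le hx (by linarith)
        _ = x := Real.rpow_one x
    have h4 : N ^ 4 ≤ x ^ 4 := pow_le_pow_left₀ hN0.le hNx 4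
    have h5 : Q ^ 4 ≤ (2 * x) ^ 4 := pow_le_pow_left₀ hQ0.le hQx 4
    rw [show (10 : ℝ) = ((10 : ℕ) : ℝ) by norm_num, Real.rpow_natCast]
    calc 4 * N * Q * (2 * N) * H * (2 * N / R) * (2 * Q)
        ≤ 4 * N * Q * (2 * N) * H * (2 * N / R) * (2 * Q) * x := le_mul_of_one_le_right hP0 hx
      _ ≤ 512 * x ^ (ε / 8) * N ^ 4 * Q ^ 4 := hPx
      _ ≤ 512 * x * x ^ 4 * (2 * x) ^ 4 := by gcongr
      _ = 8192 * x ^ 9 := by ring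
      _ ≤ x ^ 10 := by
          have : (8192 : ℝ) ≤ x := le_trans (by norm_num) hx24
          nlinarith only [this, pow_pos hx0 9]
  have hPη : (4 * N * Q * (2 * N) * H * (2 * N / R) * (2 * Q)) ^ (ε / 160) ≤ x ^ (ε / 16) := by
    calc (4 * N * Q * (2 * N) * H * (2 * N / R) * (2 * Q)) ^ (ε / 160)
        ≤ (x ^ (10 : ℝ)) ^ (ε / 160) := Real.rpow_le_rpow hP0 hP10 (by positivity)
      _ = x ^ (ε / 16) := by rw [← Real.rpow_mul hx0.le]; ring_nf
  -- (g) assemble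
  have hsum : 4 * N * Q * (2 * N) * H * (2 * N / R) * (2 * Q) +
      H * ((2 * N / R) * (2 * Q)) ^ (1 / 2 : ℝ) * (H + 2 * Q) ^ (1 / 2 : ℝ) * B ^ (1 / 2 : ℝ) ≤
      3 * N ^ 2 * Q ^ 3 * x ^ (-(ε / 4)) := by
    calc 4 * N * Q * (2 * N) * H * (2 * N / R) * (2 * Q) +
          H * ((2 * N / R) * (2 * Q)) ^ (1 / 2 : ℝ) * (H + 2 * Q) ^ (1 / 2 : ℝ) * B ^ (1 / 2 : ℝ)
        ≤ N ^ 2 * Q ^ 3 * x ^ (-(ε / 4)) + 2 * N ^ 2 * Q ^ 3 * x ^ (-(ε / 4)) := add_le_add hP1 hF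
      _ = 3 * N ^ 2 * Q ^ 3 * x ^ (-(ε / 4)) := by ring
  calc (4 * N * Q * (2 * N) * H * (2 * N / R) * (2 * Q)) ^ (ε / 160) *
        (4 * N * Q * (2 * N) * H * (2 * N / R) * (2 * Q) +
          H * ((2 * N / R) * (2 * Q)) ^ (1 / 2 : ℝ) * (H + 2 * Q) ^ (1 / 2 : ℝ) * B ^ (1 / 2 : ℝ))
      ≤ x ^ (ε / 16) * (3 * N ^ 2 * Q ^ 3 * x ^ (-(ε / 4))) :=
        mul_le_mul hPη hsum hT0 (by positivity)
    _ = 3 * N ^ 2 * Q ^ 3 * x ^ (-(3 * ε / 16)) := by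
        rw [show -(3 * ε / 16) = ε / 16 + -(ε / 4) by ring, Real.rpow_add hx0]; ring

/-! ### `ℛ₁` from Lemma 1 in the range of Theorem 1 -/

open Classical in
/-- `ℛ₁ = 0` when there are no frequencies (`H = 0`). [folklore] -/
theorem calR1_zero_freq (a : ℤ) (M Y N Q R Q₀ : ℝ) (β γ : ℕ → ℝ) :
    calR1 a M Y N Q R Q₀ β γ 0 = 0 := by
  unfold calR1 oscR
  rw [Finset.Icc_eq_empty_iff.2 (by omega)]
  simp

/-- `√(T_γ²(2Q+1)T_τ‖β‖⁴) · √((T_γ/Q)²T_τ(E+E)) ≤ T_γ²T_τ‖β‖²/Q · √(8QE)` for `Q ≥ 1/2`, `T_γ, T_τ, E ≥ 0`.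
[folklore] -/
theorem sqrt_mul_sqrt_le {Q Tγ Tτ E L : ℝ} (hQ : 1 / 2 ≤ Q) (hTτ : 0 ≤ Tτ)
    (hE : 0 ≤ E) (hL : 0 ≤ L) :
    Real.sqrt (Tγ ^ 2 * (2 * Q + 1) * Tτ * L ^ 2) * Real.sqrt ((Tγ / Q) ^ 2 * (Tτ * (E + E))) ≤
      Tγ ^ 2 * Tτ * L / Q * Real.sqrt (8 * Q * E) := by
  have hQ0 : 0 < Q := by linarith
  rw [← Real.sqrt_mul (by positivity)]
  have h1 : Tγ ^ 2 * (2 * Q + 1) * Tτ * L ^ 2 * ((Tγ / Q) ^ 2 * (Tτ * (E + E))) ≤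
      (Tγ ^ 2 * Tτ * L / Q) ^ 2 * (8 * Q * E) := by
    have h41 : 2 * Q + 1 ≤ 4 * Q := by linarith
    calc Tγ ^ 2 * (2 * Q + 1) * Tτ * L ^ 2 * ((Tγ / Q) ^ 2 * (Tτ * (E + E)))
        = (Tγ ^ 2 * Tτ * L / Q) ^ 2 * (2 * (2 * Q + 1) * E) := by field_simp; ring
      _ ≤ (Tγ ^ 2 * Tτ * L / Q) ^ 2 * (2 * (4 * Q) * E) := by gcongr
      _ = (Tγ ^ 2 * Tτ * L / Q) ^ 2 * (8 * Q * E) := by ring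
  calc Real.sqrt (Tγ ^ 2 * (2 * Q + 1) * Tτ * L ^ 2 * ((Tγ / Q) ^ 2 * (Tτ * (E + E))))
      ≤ Real.sqrt ((Tγ ^ 2 * Tτ * L / Q) ^ 2 * (8 * Q * E)) := Real.sqrt_le_sqrt h1
    _ = Tγ ^ 2 * Tτ * L / Q * Real.sqrt (8 * Q * E) := by
        rw [Real.sqrt_mul (sq_nonneg _), Real.sqrt_sq (by positivity)]

/-- **`ℛ₁` in the range of Theorem 1, from Lemma 1** (BFI §8, (8.2) + Lemma 6 + (8.5)–(8.6),
pp. 226–228: "Combining this with (8.2) we end up with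
`ℛ₁ ≪ ‖β‖²R⁻¹x^{1/2+ε}{NQ^{1/2} + N^{1/4}Q^{5/4}R^{1/4} + N^{1/2}QR^{1/4}}`. This bound satisfies (7.6)
provided (8.5) and (8.6)").  For `a ≠ 0`, `0 < ε ≤ 1` there is `K > 0` (depending on `a, ε` and the
constant of Lemma 6, i.e. of Lemma 1) such that for `x ≥ 1` with `x^{ε/8} ≥ 2²⁴`, `MN = x`,
`M, N ≥ 1`, `Q, R ≥ 1/2`, `x^εR ≤ N`, `x^{2ε}N²Q ≤ x`, `x^εNQ⁵R ≤ x²`, `x^εN²Q⁴R ≤ x²`, every frequency cut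
`H ≤ 16x^{ε/8}Q²R/M`, `Q₀ ≥ 0`, bounds `|γ_q| ≤ T_γ` (`q ∼ Q`, `T_γ > 0`), `τ(c) ≤ T_τ` (`c ≤ 4NQ`):
`‖ℛ₁(M, M/2; H)‖ ≤ K Q₀² T_γ² T_τ x^{1−3ε/32} ‖β‖² / R`.
PROVED from `BFI.norm_calR1_le`, `BFI.L6.dispA_le_of_lemma1` (for `a` and `−a`) and
`BFI.lemma6_rhs_le_of_range`; the input is Lemma 1 as the hypothesis
`BFI.Lemma1BoundFor BFI.plateau2 (5/4)`. [cite: BombieriFriedlanderIwaniecActa1986, §8 pp. 226–228] -/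
theorem norm_calR1_le_of_lemma1 (hLB : Lemma1BoundFor plateau2 (5 / 4)) {a : ℤ} (ha : a ≠ 0)
    {ε : ℝ} (hε : 0 < ε) (hε1 : ε ≤ 1) :
    ∃ K : ℝ, 0 < K ∧ ∀ x M N Q R Q₀ Tγ Tτ : ℝ, ∀ H : ℕ,
      1 ≤ x → (2 : ℝ) ^ 24 ≤ x ^ (ε / 8) → M * N = x → 1 ≤ M → 1 ≤ N → 1 / 2 ≤ Q → 1 / 2 ≤ R →
      x ^ ε * R ≤ N → x ^ (2 * ε) * (N ^ 2 * Q) ≤ x → x ^ ε * (N * Q ^ 5 * R) ≤ x ^ 2 →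
      x ^ ε * (N ^ 2 * Q ^ 4 * R) ≤ x ^ 2 → (H : ℝ) ≤ 16 * x ^ (ε / 8) * Q ^ 2 * R / M →
      0 ≤ Q₀ → 0 < Tγ → 0 ≤ Tτ →
      ∀ β γ : ℕ → ℝ, (∀ q ∈ dyadic Q, |γ q| ≤ Tγ) →
        (∀ c ∈ Finset.Icc 1 ⌊4 * N * Q⌋₊, (σ 0 c : ℝ) ≤ Tτ) →
        ‖calR1 a M (M / 2) N Q R Q₀ β γ H‖ ≤
          K * Q₀ ^ 2 * Tγ ^ 2 * Tτ * x ^ (1 - 3 * ε / 32) * l2Sq N β / R := by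
  -- Lemma 6 for `a` and `-a`
  obtain ⟨C₆p, hC₆p⟩ := L6.dispA_le_of_lemma1 hLB a ha (ε / 160) (by positivity)
  obtain ⟨C₆n, hC₆n⟩ := L6.dispA_le_of_lemma1 hLB (-a) (neg_ne_zero.2 ha) (ε / 160) (by positivity)
  set C₆ : ℝ := max (max C₆p C₆n) 1 with hC₆def
  have hC₆1 : 1 ≤ C₆ := le_max_right _ _
  have hC₆0 : 0 < C₆ := by linarith
  have hpC : C₆p ≤ C₆ := (le_max_left _ _).trans (le_max_left _ _)
  have hnC : C₆n ≤ C₆ := (le_max_right _ _).trans (le_max_left _ _)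
  refine ⟨5 * Real.sqrt (24 * C₆), by positivity, ?_⟩
  intro x M N Q R Q₀ Tγ Tτ H hx hxε hMN hM hN hQ hR hRN h85 h86a h86b hH hQ₀ hTγ hTτ β γ hγ hτ
  have hx0 : 0 < x := by linarith
  have hN0 : 0 < N := by linarith
  have hM0 : 0 < M := by linarith
  have hQ0 : 0 < Q := by linarith
  have hR0 : 0 < R := by linarith
  have hl := l2Sq_nonneg N β
  have hrhs0 : 0 ≤ 5 * Real.sqrt (24 * C₆) * Q₀ ^ 2 * Tγ ^ 2 * Tτ * x ^ (1 - 3 * ε / 32) *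
      l2Sq N β / R := by positivity
  -- no frequencies: `ℛ₁ = 0`
  rcases Nat.eq_zero_or_pos H with hH0 | hHpos
  · subst hH0
    rw [calR1_zero_freq, norm_zero]
    exact hrhs0
  -- the bound `E` for `𝒜(±a)`
  have hRN' : R ≤ N := by
    calc R = 1 * R := (one_mul R).symm
      _ ≤ x ^ ε * R := mul_le_mul_of_nonneg_right (Real.one_le_rpow hx hε.le) hR0.le
      _ ≤ N := hRN
  set E : ℝ := C₆ * (3 * N ^ 2 * Q ^ 3 * x ^ (-(3 * ε / 16))) with hEdef
  have hE0 : 0 ≤ E := by positivity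
  have hnum := lemma6_rhs_le_of_range hx hxε hε hε1 hMN hM hN hQ hR hRN h85 h86a h86b
    (Nat.cast_nonneg H) hH
  have hC1 : (1 : ℝ) ≤ 4 * N * Q := by nlinarith
  have hD1 : (1 : ℝ) ≤ 2 * N := by linarith
  have hK1 : (1 : ℝ) ≤ 2 * N / R := by
    rw [le_div_iff₀ hR0]; linarith
  have hH1 : (1 : ℝ) ≤ (H : ℝ) := by exact_mod_cast hHpos
  have hQ1 : (1 : ℝ) ≤ 2 * Q := by linarith
  have hX0 : 0 ≤ (4 * N * Q * (2 * N) * (H : ℝ) * (2 * N / R) * (2 * Q)) ^ (ε / 160) *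
      (4 * N * Q * (2 * N) * (H : ℝ) * (2 * N / R) * (2 * Q) +
        (H : ℝ) * ((2 * N / R) * (2 * Q)) ^ (1 / 2 : ℝ) * ((H : ℝ) + 2 * Q) ^ (1 / 2 : ℝ) *
          (4 * N * Q * ((2 * Q) ^ 2 + (H : ℝ) * (2 * N / R) * (2 * Q)) * (4 * N * Q + 2 * N * (2 * Q) ^ 2) +
            (4 * N * Q) ^ 2 * (2 * N) * (2 * Q) *
              ((2 * Q) ^ 2 + (H : ℝ) * (2 * N / R) * (2 * Q)) ^ (1 / 2 : ℝ) +
            (2 * N) ^ 2 * (H : ℝ) * (2 * N / R) * (2 * Q) ^ 3) ^ (1 / 2 : ℝ)) := by positivity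
  have hE : ∀ s ∈ ({1, -1} : Finset ℤ), ∀ α : ℕ → ℕ → ℂ, (∀ h q, ‖α h q‖ ≤ 1) →
      dispA (a * s) (4 * N * Q) (2 * N) (2 * N / R) (H : ℝ) (2 * Q) α ≤ E := by
    intro s hs α hα
    rw [Finset.mem_insert, Finset.mem_singleton] at hs
    rcases hs with rfl | rfl
    · rw [mul_one]
      refine (hC₆p _ _ _ _ _ hC1 hD1 hK1 hH1 hQ1 α hα).trans ?_
      refine (mul_le_mul_of_nonneg_right hpC hX0).trans ?_
      exact mul_le_mul_of_nonneg_left hnum hC₆0.le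
    · rw [mul_neg, mul_one]
      refine (hC₆n _ _ _ _ _ hC1 hD1 hK1 hH1 hQ1 α hα).trans ?_
      refine (mul_le_mul_of_nonneg_right hnC hX0).trans ?_
      exact mul_le_mul_of_nonneg_left hnum hC₆0.le
  -- (8.2)
  have hY : 0 < M / 2 := by positivity
  have hYM : M / 2 ≤ M := by linarith
  have hmain := norm_calR1_le (a := a) hY hYM hN hQ hR hQ₀ hTγ hγ hTτ hτ β H hE
  refine hmain.trans ?_
  -- `√(8QE) = √(24C₆) N Q² x^{-3ε/32}`
  have hs8 : Real.sqrt (8 * Q * E) = Real.sqrt (24 * C₆) * N * Q ^ 2 * x ^ (-(3 * ε / 32)) := by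
    have hx2 : (x ^ (-(3 * ε / 32))) ^ 2 = x ^ (-(3 * ε / 16)) := by
      rw [← Real.rpow_natCast, ← Real.rpow_mul hx0.le]; ring_nf
    have e : 8 * Q * E = (Real.sqrt (24 * C₆) * N * Q ^ 2 * x ^ (-(3 * ε / 32))) ^ 2 := by
      rw [mul_pow, mul_pow, mul_pow, hx2, Real.sq_sqrt (by positivity), hEdef]; ring
    rw [e, Real.sqrt_sq (by positivity)]
  have hx1 : x ^ (1 - 3 * ε / 32) = x * x ^ (-(3 * ε / 32)) := by
    rw [show (1 : ℝ) - 3 * ε / 32 = 1 + -(3 * ε / 32) by ring, Real.rpow_add hx0, Real.rpow_one]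
  calc 2 * ((2 * M + M / 2) * Q₀ ^ 2 / (Q * R)) *
        (Real.sqrt (Tγ ^ 2 * (2 * Q + 1) * Tτ * l2Sq N β ^ 2) *
          Real.sqrt ((Tγ / Q) ^ 2 * (Tτ * (E + E))))
      ≤ 2 * ((2 * M + M / 2) * Q₀ ^ 2 / (Q * R)) *
          (Tγ ^ 2 * Tτ * l2Sq N β / Q * Real.sqrt (8 * Q * E)) :=
        mul_le_mul_of_nonneg_left (sqrt_mul_sqrt_le hQ hTτ hE0 hl) (by positivity)
    _ = 5 * Real.sqrt (24 * C₆) * Q₀ ^ 2 * Tγ ^ 2 * Tτ * x ^ (1 - 3 * ε / 32) * l2Sq N β / R := by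
        rw [hs8, hx1, ← hMN]
        field_simp
        ring

end BFI

end Literature.NumberTheory.Sieve
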